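import Summits.Ventures.CertifiedArithmetic.LowPrec.SRBoxCertificate
import HarnessLib

/-!
# Stochastic rounding into a finite format, XIX: the exact forward law (polynomial cost)

HONEST FRAMING: certified error envelopes and provably optimal rounding/accumulation schemes for
low-precision formats under stated cost models; every table by two implementations; no hardware or
vendor claims.

Venture CertifiedArithmetic / lowprec, SR slice (gen5). The semantics `treeExpE F e T φ` (files X,
XVII) is an expectation over `2^m` rounding branches (`m` = number of additions); evaluating it by
branch enumeration is exponential. But the rounded value of every node lies in the finite format `F`,
so the JOINT LAW of (node value, exit flag) has at most `2·|F|` atoms at every node, and the law of a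
node is a bilinear image of the laws of its children: a forward DYNAMIC PROGRAMME of cost
`O(m · A_l · A_r · |F|)` (`A` = atoms) computes the exact rational law of the root — for GIVEN data.

* `lawE F e T : List (K × Bool × K)` — the forward law as a merged association list of atoms
  `(value, flag, probability)`; `lawSum l φ = Σ p·φ(v, b)`.
* **`treeExpE_eq_lawSum`**: `treeExpE F e T φ = lawSum (lawE F e T) φ` for every integrand — the DP
  is exact (proof: bilinearity of the node recursion + merging equal atoms preserves every `lawSum`).
  Corollaries `exitE_eq_lawSum`, `satProbT_eq_lawSum`.
* Kernel instances (`decide +kernel` on the DP, not on branches): FP6 E3M2, left comb ("recursive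
  summation") of `n = 16 / 24 / 32` ones: `P(sat) = 1/1024`, `18112973/2^26 ≈ 0.2699`,
  `3260157053385/2^42 ≈ 0.7413` exactly (`2^15 … 2^31` branches; the DP has ≤ 9 atoms per node) —
  a THIRD implementation of rows `e3m2:unit:seq:16|24|32` of `certs/sr/gen5/EXACT_cases_{A,B}.csv`.
* With the box certificate (file XVIII): **every E3M2 recursive SR sum of 16 numbers in `[0, 1]`
  saturates with probability ≤ 1/1024; of 24 numbers ≤ 0.2699…; of 32 numbers ≤ 0.7413…** — sharp
  (attained at the all-ones corner), no hypothesis on representability of the data, no enumeration.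
  The FP8 rows of the same table (E4M3 `n ≤ 256`, E5M2 `n ≤ 4096`, named data vectors) are
  two-implementation exact computations outside the kernel (`code/sr/gen5/exactlaw_{A,B}.py`).
-/

namespace Summit.Ventures.CertifiedArithmetic.LowPrec.SR

open Literature.ComputerArithmetic.ConnollyHighamMary2021 Finset STree

variable {K : Type*} [Field K] [LinearOrder K] [IsStrictOrderedRing K]

/-! ### Association lists of atoms -/

/-- `lawSum l φ = Σ_{(v, b, p) ∈ l} p · φ v b`. -/
def lawSum (l : List (K × Bool × K)) (φ : K → Bool → K) : K :=
  (l.map fun a => a.2.2 * φ a.1 a.2.1).sum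

/-- Insert an atom, adding its probability to an existing atom with the same (value, flag). -/
def insertAdd : K × Bool × K → List (K × Bool × K) → List (K × Bool × K)
  | a, [] => [a]
  | (v, b, p), (v', b', p') :: l =>
      if v = v' ∧ b = b' then (v', b', p' + p) :: l else (v', b', p') :: insertAdd (v, b, p) l

/-- Merge equal atoms of a list. -/
def mergeAtoms (l : List (K × Bool × K)) : List (K × Bool × K) := l.foldr insertAdd []

omit [LinearOrder K] [IsStrictOrderedRing K] in
/-- `lawSum` of a cons. -/
theorem lawSum_cons (a : K × Bool × K) (l : List (K × Bool × K)) (φ : K → Bool → K) :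
    lawSum (a :: l) φ = a.2.2 * φ a.1 a.2.1 + lawSum l φ := by
  simp [lawSum]

omit [LinearOrder K] [IsStrictOrderedRing K] in
/-- `lawSum` of the empty list. -/
theorem lawSum_nil (φ : K → Bool → K) : lawSum ([] : List (K × Bool × K)) φ = 0 := by
  simp [lawSum]

omit [LinearOrder K] [IsStrictOrderedRing K] in
/-- `lawSum` is additive over concatenation. -/
theorem lawSum_append (l l' : List (K × Bool × K)) (φ : K → Bool → K) :
    lawSum (l ++ l') φ = lawSum l φ + lawSum l' φ := by
  simp [lawSum, List.sum_append]

omit [LinearOrder K] [IsStrictOrderedRing K] in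
/-- `lawSum` of a `flatMap` is the sum of the `lawSum`s. -/
theorem lawSum_flatMap {α : Type*} (L : List α) (f : α → List (K × Bool × K)) (φ : K → Bool → K) :
    lawSum (L.flatMap f) φ = (L.map fun a => lawSum (f a) φ).sum := by
  induction L with
  | nil => simp [lawSum]
  | cons a L ih => rw [List.flatMap_cons, lawSum_append, ih]; simp

omit [LinearOrder K] [IsStrictOrderedRing K] in
/-- Scalar multiples enter `lawSum` atomwise. -/
theorem mul_sum_map {α : Type*} (c : K) (L : List α) (g : α → K) :
    c * (L.map g).sum = (L.map fun a => c * g a).sum := by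
  induction L with
  | nil => simp
  | cons a L ih => simp [mul_add, ih]

omit [IsStrictOrderedRing K] in
/-- `insertAdd` preserves every `lawSum`. -/
theorem lawSum_insertAdd (a : K × Bool × K) :
    ∀ (l : List (K × Bool × K)) (φ : K → Bool → K),
      lawSum (insertAdd a l) φ = a.2.2 * φ a.1 a.2.1 + lawSum l φ
  | [], φ => by simp [insertAdd, lawSum]
  | (v', b', p') :: l, φ => by
      obtain ⟨v, b, p⟩ := a
      simp only [insertAdd]
      split_ifs with h
      · obtain ⟨rfl, rfl⟩ := h
        simp only [lawSum_cons]; ring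
      · rw [lawSum_cons, lawSum_cons, lawSum_insertAdd (v, b, p) l φ]; ring

omit [IsStrictOrderedRing K] in
/-- Merging preserves every `lawSum`. -/
theorem lawSum_mergeAtoms (l : List (K × Bool × K)) (φ : K → Bool → K) :
    lawSum (mergeAtoms l) φ = lawSum l φ := by
  induction l with
  | nil => rfl
  | cons a l ih =>
      simp only [mergeAtoms, List.foldr_cons] at ih ⊢
      rw [lawSum_insertAdd, ih, lawSum_cons]

/-! ### The forward law -/

/-- **The forward law** of `(root value, exit flag)`: leaves are Dirac; a node maps each pair of child
atoms `(a, fa, pa)`, `(b, fb, pb)` to the two atoms `(⌈a+b⌉, fl, pa·pb·p↑)` and `(⌊a+b⌋, fl, pa·pb·(1−p↑))`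
with `fl = fa ∨ fb ∨ e(a+b)`, then merges equal atoms. -/
def lawE (F : Finset K) (e : K → Bool) : STree K → List (K × Bool × K)
  | .leaf x => [(x, false, 1)]
  | .node l r =>
      mergeAtoms ((lawE F e l).flatMap fun a => (lawE F e r).flatMap fun b =>
        [(up F (a.1 + b.1), a.2.1 || b.2.1 || e (a.1 + b.1), a.2.2 * b.2.2 * pUp F (a.1 + b.1)),
         (dn F (a.1 + b.1), a.2.1 || b.2.1 || e (a.1 + b.1), a.2.2 * b.2.2 * (1 - pUp F (a.1 + b.1)))])

omit [IsStrictOrderedRing K] in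
/-- **The DP is exact**: `treeExpE F e T φ = Σ_{atoms} p · φ(v, b)` for every integrand `φ`. -/
theorem treeExpE_eq_lawSum (F : Finset K) (e : K → Bool) :
    ∀ (T : STree K) (φ : K → Bool → K), treeExpE F e T φ = lawSum (lawE F e T) φ
  | .leaf x, φ => by simp [treeExpE, lawE, lawSum]
  | .node l r, φ => by
      simp only [treeExpE, lawE]
      rw [treeExpE_eq_lawSum F e l, lawSum_mergeAtoms, lawSum_flatMap]
      simp only [lawSum_flatMap]
      unfold lawSum
      refine congrArg (fun f => ((lawE F e l).map f).sum) (funext fun A => ?_)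
      beta_reduce
      rw [treeExpE_eq_lawSum F e r]
      unfold lawSum
      rw [mul_sum_map]
      refine congrArg (fun f => ((lawE F e r).map f).sum) (funext fun B => ?_)
      simp only [List.map_cons, List.map_nil, List.sum_cons, List.sum_nil, step]
      ring

omit [IsStrictOrderedRing K] in
/-- Exit probabilities by the DP. -/
theorem exitE_eq_lawSum (F : Finset K) (e : K → Bool) (T : STree K) :
    exitE F e T = lawSum (lawE F e T) (fun _ fl => if fl then 1 else 0) :=
  treeExpE_eq_lawSum F e T _

omit [IsStrictOrderedRing K] in
/-- The saturation probability of file X by the DP (hull `[lo, hi]`). -/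
theorem satProbT_eq_lawSum {F : Finset K} {lo hi : K} (hlo : lo ∈ F) (hhi : hi ∈ F)
    (hb : ∀ y ∈ F, lo ≤ y ∧ y ≤ hi) (T : STree K) :
    satProbT F T = lawSum (lawE F (fun c => decide (c < lo) || decide (hi < c)) T)
      (fun _ fl => if fl then 1 else 0) := by
  rw [satProbT_eq_exitE hlo hhi hb, exitE_eq_lawSum]

omit [IsStrictOrderedRing K] in
/-- The total mass of the law is one. -/
theorem lawSum_one (F : Finset K) (e : K → Bool) (T : STree K) :
    lawSum (lawE F e T) (fun _ _ => 1) = 1 := by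
  rw [← treeExpE_eq_lawSum]
  induction T with
  | leaf x => rfl
  | node l r ihl ihr =>
      simp only [treeExpE]
      have : ∀ (a : K) (fa : Bool), treeExpE F e r (fun b fb =>
          step F (a + b) (fun v => (fun (_ : K) (_ : Bool) => (1 : K)) v (fa || fb || e (a + b)))) = 1 :=
        fun a fa => by simp only [step_const]; exact ihr
      rw [treeExpE_congr F e l (fun a fa => this a fa)]; exact ihl

/-! ### Kernel instances: FP6 E3M2, recursive summation of ones -/

namespace LawE3M2

/-- Hull facts of the E3M2 literal (63 values, `±28`). -/
theorem e3m2_hull : (-28 : ℚ) ∈ Formats.e3m2 ∧ (28 : ℚ) ∈ Formats.e3m2 ∧ (0 : ℚ) ∈ Formats.e3m2 ∧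
    ∀ y ∈ Formats.e3m2, (-28 : ℚ) ≤ y ∧ y ≤ 28 := by
  decide +kernel

/-- Upper-exit probability of the left comb of `n + 1` ones, by the DP. -/
def cornerUp (n : ℕ) : ℚ :=
  lawSum (lawE Formats.e3m2 (fun c => decide ((28 : ℚ) < c)) (comb (fun _ => (1 : ℚ)) 1 n))
    (fun _ fl => if fl then 1 else 0)

/-- `cornerUp n` is the upper-exit probability of the corner tree. -/
theorem cornerUp_eq (n : ℕ) :
    exitE Formats.e3m2 (fun c => decide ((28 : ℚ) < c)) (comb (fun _ => (1 : ℚ)) 1 n) = cornerUp n :=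
  exitE_eq_lawSum _ _ _

/-- **E3M2, 16 ones, recursive SR summation: P(some partial sum exits upward) = 1/1024** (DP in the
kernel; `2^15` branches otherwise). -/
theorem cornerUp_15 : cornerUp 15 = 1 / 1024 := by decide +kernel

/-- **24 ones: 18112973 / 2^26 (≈ 0.26990).** -/
theorem cornerUp_23 : cornerUp 23 = 18112973 / 67108864 := by decide +kernel

/-- **32 ones: 3260157053385 / 2^42 (≈ 0.74127).** -/
theorem cornerUp_31 : cornerUp 31 = 3260157053385 / 4398046511104 := by decide +kernel

/-- **BOX CERTIFICATE, E3M2, n = 16**: every recursive SR sum `((s + x₀) + x₁) + ⋯ + x₁₄` of sixteen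
rationals in `[0, 1]` saturates with probability at most `1/1024` (sharp: attained at all ones). -/
theorem box16 (x : ℕ → ℚ) (s : ℚ) (hs : 0 ≤ s ∧ s ≤ 1) (hx : ∀ i, 0 ≤ x i ∧ x i ≤ 1) :
    satProbT Formats.e3m2 (comb x s 15) ≤ 1 / 1024 := by
  obtain ⟨hlo, hhi, h0, hb⟩ := e3m2_hull
  have h₁ : LeafLE ((comb x s 15).map fun _ => (0 : ℚ)) (comb x s 15) := by
    rw [map_comb]; exact leafLE_comb hs.1 (fun i => (hx i).1) 15
  have h₂ : LeafLE (comb x s 15) (comb (fun _ => (1 : ℚ)) 1 15) :=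
    leafLE_comb hs.2 (fun i => (hx i).2) 15
  have h := satProbT_le_upper_corner hlo hhi hb h0 (by norm_num) h₁ h₂
  rw [cornerUp_eq, cornerUp_15] at h; exact h

/-- **BOX CERTIFICATE, E3M2, n = 24**: `P(sat) ≤ 18112973 / 2^26 < 0.2700` on `[0, 1]^24`. -/
theorem box24 (x : ℕ → ℚ) (s : ℚ) (hs : 0 ≤ s ∧ s ≤ 1) (hx : ∀ i, 0 ≤ x i ∧ x i ≤ 1) :
    satProbT Formats.e3m2 (comb x s 23) ≤ 18112973 / 67108864 := by
  obtain ⟨hlo, hhi, h0, hb⟩ := e3m2_hull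
  have h₁ : LeafLE ((comb x s 23).map fun _ => (0 : ℚ)) (comb x s 23) := by
    rw [map_comb]; exact leafLE_comb hs.1 (fun i => (hx i).1) 23
  have h₂ : LeafLE (comb x s 23) (comb (fun _ => (1 : ℚ)) 1 23) :=
    leafLE_comb hs.2 (fun i => (hx i).2) 23
  have h := satProbT_le_upper_corner hlo hhi hb h0 (by norm_num) h₁ h₂
  rw [cornerUp_eq, cornerUp_23] at h; exact h

/-- **BOX CERTIFICATE, E3M2, n = 32**: `P(sat) ≤ 3260157053385 / 2^42 < 0.7413` on `[0, 1]^32`. -/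
theorem box32 (x : ℕ → ℚ) (s : ℚ) (hs : 0 ≤ s ∧ s ≤ 1) (hx : ∀ i, 0 ≤ x i ∧ x i ≤ 1) :
    satProbT Formats.e3m2 (comb x s 31) ≤ 3260157053385 / 4398046511104 := by
  obtain ⟨hlo, hhi, h0, hb⟩ := e3m2_hull
  have h₁ : LeafLE ((comb x s 31).map fun _ => (0 : ℚ)) (comb x s 31) := by
    rw [map_comb]; exact leafLE_comb hs.1 (fun i => (hx i).1) 31
  have h₂ : LeafLE (comb x s 31) (comb (fun _ => (1 : ℚ)) 1 31) :=
    leafLE_comb hs.2 (fun i => (hx i).2) 31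
  have h := satProbT_le_upper_corner hlo hhi hb h0 (by norm_num) h₁ h₂
  rw [cornerUp_eq, cornerUp_31] at h; exact h

/-- The corner attains the bound: at all ones `P(sat) = 1/1024` exactly (n = 16). -/
theorem corner16_sharp : satProbT Formats.e3m2 (comb (fun _ => (1 : ℚ)) 1 15) = 1 / 1024 := by
  obtain ⟨hlo, hhi, h0, hb⟩ := e3m2_hull
  refine le_antisymm (box16 _ 1 (by norm_num) (fun _ => by norm_num)) ?_
  have h := exitE_upper_le_satProbT hlo hhi hb (comb (fun _ => (1 : ℚ)) 1 15)
  rw [cornerUp_eq, cornerUp_15] at h; exact h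

end LawE3M2

end Summit.Ventures.CertifiedArithmetic.LowPrec.SR
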